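import Mathlib
import HarnessLib

/-!
# Candela–de Roton, *On sets with small sumset in the circle* — Theorem 1.6

P. Candela, A. de Roton, Q. J. Math. 70 (2019) 49–69 (arXiv:1709.04501): a continuous analogue in
`𝕋 = ℝ/ℤ` of the Serra–Zémor result toward Freiman's `3k − 4` theorem in `ℤ/pℤ`: a set of the circle
with doubling `μ(A + A) = (2 + ε) μ(A)`, `ε ≤ 10⁻⁴`, and `μ(A + A) < 1/2 + μ(A)` is, after a dilation
`x ↦ nx`, contained in an interval of length `μ(A + A) − μ(A)` [cite: CandelaDeRoton2019, Theorem 1.6].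
The proof (§2 of the source) transfers the `ℤ/pℤ` theorem of Serra–Zémor by discretisation and a
compactness argument; it is NOT formalised here — the result is vendored as a named fact, in the special
case of compact sets (where the inner Haar measure of the source is Mathlib's `volume`), for the Parity
ideation cell (parity-ideate-p4 ROUND-4 §3/§4, tool «ceiling_lift» for task T5-1 `CircleCap (5/9 − δ)`).

Conventions of the source (p. 3): `μ` is the inner Haar measure on `𝕋` ("the supremum of the Haar measures
of closed sets included in `A`"), `ℕ` is the set of positive integers, `n·A` is the image of `A` under
`x ↦ nx`, and an interval of `𝕋` is the image of an interval of `ℝ` (closed / open accordingly).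
-/

open MeasureTheory Set
open scoped Pointwise

namespace Literature.Combinatorics.Additive

/-- **Candela–de Roton 2019, Theorem 1.6** (as printed): "Let `0 ≤ ε ≤ 10⁻⁴`. Let `A ⊂ 𝕋` satisfy
`μ(A) > 0` and `μ(A+A) = (2+ε) μ(A) < 1/2 + μ(A)`. Then there exist intervals `I, K ⊂ 𝕋`, with `I`
closed, `K` open and `n ∈ ℕ`, such that `n·A ⊂ I`, `K ⊂ n·(A+A)`, `μ(I) ≤ μ(A+A) − μ(A)` and
`μ(K) ≥ 2μ(A)`."
Rendering: `𝕋 = UnitAddCircle = ℝ/ℤ` with its Haar probability measure `volume`; the statement is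
given for COMPACT `A` (then `A + A` is compact and the inner Haar measure `μ` of the source coincides with
`volume` on `A`, `A + A`, and on the intervals); `n·A = (x ↦ n • x) '' A` with `n ≥ 1`; the closed
interval `I` is `(↑) '' Icc a b` and the open interval `K` is `(↑) '' Ioo c d` for reals `a, b, c, d`.
-- TODO(general form): arbitrary `A ⊂ 𝕋` of positive inner Haar measure (Mathlib has no inner-measure
-- API); the compact case is the special case used by the requester.
[cite: CandelaDeRoton2019, Theorem 1.6] -/
def CandelaDeRoton2019_theorem16 : Prop :=
  ∀ ε : ℝ, 0 ≤ ε → ε ≤ 1 / 10 ^ 4 →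
    ∀ A : Set UnitAddCircle, IsCompact A → 0 < volume.real A →
      volume.real (A + A) = (2 + ε) * volume.real A →
      volume.real (A + A) < 1 / 2 + volume.real A →
        ∃ (n : ℕ) (a b c d : ℝ), 1 ≤ n ∧
          (fun x : UnitAddCircle => n • x) '' A ⊆ ((↑) : ℝ → UnitAddCircle) '' Set.Icc a b ∧
          ((↑) : ℝ → UnitAddCircle) '' Set.Ioo c d ⊆ (fun x : UnitAddCircle => n • x) '' (A + A) ∧
          volume.real (((↑) : ℝ → UnitAddCircle) '' Set.Icc a b) ≤
            volume.real (A + A) - volume.real A ∧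
          2 * volume.real A ≤ volume.real (((↑) : ℝ → UnitAddCircle) '' Set.Ioo c d)

/-- The doubling hypothesis of Theorem 1.6 in the form `μ(A+A) ≤ (2 + 10⁻⁴) μ(A)`: any `A` with
`2μ(A) ≤ μ(A+A) ≤ (2 + 10⁻⁴) μ(A)` has `μ(A+A) = (2+ε)μ(A)` for some admissible `ε` (elementary
repackaging, for consumers who bound the doubling rather than name `ε`). [cite: CandelaDeRoton2019, Theorem 1.6] -/
theorem CandelaDeRoton2019_theorem16.exists_eps {A : Set UnitAddCircle} (h0 : 0 < volume.real A)
    (hlo : 2 * volume.real A ≤ volume.real (A + A))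
    (hhi : volume.real (A + A) ≤ (2 + 1 / 10 ^ 4) * volume.real A) :
    ∃ ε : ℝ, 0 ≤ ε ∧ ε ≤ 1 / 10 ^ 4 ∧ volume.real (A + A) = (2 + ε) * volume.real A := by
  refine ⟨volume.real (A + A) / volume.real A - 2, ?_, ?_, ?_⟩
  · rw [sub_nonneg, le_div_iff₀ h0]; linarith
  · rw [sub_le_iff_le_add, div_le_iff₀ h0]; linarith
  · field_simp
    ring

/-- **Consumer form of Theorem 1.6** with the doubling bounded instead of named: compact `A ⊂ 𝕋` with
`μ(A) > 0`, `2μ(A) ≤ μ(A+A) ≤ (2 + 10⁻⁴)μ(A)` and `μ(A+A) < 1/2 + μ(A)` is, after a dilation `n ≥ 1`,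
inside a closed interval of measure `≤ μ(A+A) − μ(A)`, and `n·(A+A)` contains an open interval of
measure `≥ 2μ(A)`. [cite: CandelaDeRoton2019, Theorem 1.6] -/
theorem CandelaDeRoton2019_theorem16.of_doubling_le (h : CandelaDeRoton2019_theorem16)
    {A : Set UnitAddCircle} (hA : IsCompact A) (h0 : 0 < volume.real A)
    (hlo : 2 * volume.real A ≤ volume.real (A + A))
    (hhi : volume.real (A + A) ≤ (2 + 1 / 10 ^ 4) * volume.real A)
    (hhalf : volume.real (A + A) < 1 / 2 + volume.real A) :
    ∃ (n : ℕ) (a b c d : ℝ), 1 ≤ n ∧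
      (fun x : UnitAddCircle => n • x) '' A ⊆ ((↑) : ℝ → UnitAddCircle) '' Set.Icc a b ∧
      ((↑) : ℝ → UnitAddCircle) '' Set.Ioo c d ⊆ (fun x : UnitAddCircle => n • x) '' (A + A) ∧
      volume.real (((↑) : ℝ → UnitAddCircle) '' Set.Icc a b) ≤ volume.real (A + A) - volume.real A ∧
      2 * volume.real A ≤ volume.real (((↑) : ℝ → UnitAddCircle) '' Set.Ioo c d) := by
  obtain ⟨ε, hε0, hε1, hε⟩ := CandelaDeRoton2019_theorem16.exists_eps h0 hlo hhi
  exact h ε hε0 hε1 A hA h0 hε hhalf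

end Literature.Combinatorics.Additive
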